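import Summits.CriticalPhenomena.PercolationContinuityZ3.Theorems.PercNearOneGluingNoHeavyLowerTailFrontierDecRowsRow44CutVertex
import Summits.CriticalPhenomena.PercolationContinuityZ3.Theorems.PercNearOneGluingNoHeavyLowerTailFrontierDecRowsRow44CrossCutSide
import Summits.CriticalPhenomena.PercolationContinuityZ3.Theorems.PercNearOneGluingNoHeavyLowerTailFrontierDecRowsConeImplied
import Mathlib.Tactic.Linarith
import HarnessLib

/-!
# Row 36 across an `{a,b} | {c,y}` cut vertex (route `PercNearOneGluingNoHeavy`, supports-only; prim-l12-p6 g15)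

Frontier dec row 36 is `E₃(D[a|b], D[a|c], D[b|y]) ≥ 0` (the path `c – a – b – y`).  Here a cut vertex `h` separates `{a,b}` (colour `true`) from
`{c,y}` (colour `false`).  With `…Row36CutVertex` (`{a,c} | {b,y}`, gen 14) and `…Row36ThreeOneCutA/C/All` (all `3 | 1` cuts) this leaves only the
split `{a,y} | {b,c}` among the cut vertices separating the terminals of row 36 (memo §8.4).

THEOREM (`sahiE3_row36_nonneg_of_cutVertexAB`).  Unconditionally `0 ≤ E₃(row 36 at (a,b,c,y))` on such a graph.
PROOF.  Near side `(a,b,h)`: `k = P(a↔b)`, `p_a = P(a↔h)`, `p_b = P(b↔h)`, `t = P(a↔h↔b)`; far side: `k_c = P(h↔c)`, `k_y = P(h↔y)`, `k_cy = P(both)`.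
The glued probabilities give `E₃ = k_c(t − p_a k) + k_y(t − p_b k) + k_c k_y Q − k_cy (1−k) t` with `Q = t(p_a+p_b) − p_a p_b(1+k)`, and for `k_c ≤ k_y`
  **`E₃ = (k_y − k_c)(t − p_b k) + k_c[(1 − k_y)·L + k_y·E₃(D[a|b],D[a|h],D[b|h])] + (k_c − k_cy)(1−k)t`**,
`L = t(1 − p_a − p_b − k + 2t) − (k − t)(p_a + p_b − 2t) = AG + (p_a − t)(p_b − t) ≥ 0` where `AG = qt − e₂ ≥ 0` follows from the cell form
`3PT-LB = (1+t)·AG − e₃` (`frontier_43_all`); `t − p_b k ≥ 0` is Harris; symmetric formula for `k_y ≤ k_c`.  ∎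
Recorded in `run/shared/lean/prim/prim-l12/FROM-prim-l12-p6-g15-ROW44-CUT-VERTICES.md` §8.4.  No definitions, no named facts, no sorries.
-/

noncomputable section

namespace Summit.CriticalPhenomena.PercolationContinuityZ3.Theorems.FrontierDecRows

open MeasureTheory CovTransferCert E3GroupSepCert
open Literature.Probability.Percolation Literature.Probability.LatticeModels

variable {n : ℕ}

/-- The `{a,b} | {c,y}` identity for row 36 in real variables, with its two case certificates (see the file header). [this work] -/
theorem row36_cutVertexAB_ineq (k pa pb t kc ky kcy : ℝ) (ht0 : 0 ≤ t) (htk : t ≤ k) (hta : t ≤ pa) (htb : t ≤ pb) (hk1 : k ≤ 1)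
    (g1 : k * pa ≤ t) (g2 : k * pb ≤ t)
    (h3 : 0 ≤ 2 * (1 - k - pa - pb + 2 * t) + (1 - k) * (1 - pa) * (1 - pb) -
      ((1 - k) * (1 - pa - pb + t) + (1 - pa) * (1 - k - pb + t) + (1 - pb) * (1 - k - pa + t)))
    (hkc0 : 0 ≤ kc) (hky0 : 0 ≤ ky) (hkc1 : kc ≤ 1) (hky1 : ky ≤ 1) (hcyc : kcy ≤ kc) (hcyy : kcy ≤ ky) :
    0 ≤ 2 * ((1 - k) - (pa - t) * kc - (pb - t) * ky) + (1 - k) * (1 - pa * kc) * (1 - pb * ky) -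
      ((1 - k) * (1 - pa * kc - pb * ky + t * kcy) + (1 - pa * kc) * ((1 - k) - (pb - t) * ky) +
        (1 - pb * ky) * ((1 - k) - (pa - t) * kc)) := by
  -- the near-side quantities
  have e3 : 0 ≤ (k - t) * (pa - t) * (pb - t) := mul_nonneg (mul_nonneg (sub_nonneg.2 htk) (sub_nonneg.2 hta)) (sub_nonneg.2 htb)
  have key3 : 2 * (1 - k - pa - pb + 2 * t) + (1 - k) * (1 - pa) * (1 - pb) -
      ((1 - k) * (1 - pa - pb + t) + (1 - pa) * (1 - k - pb + t) + (1 - pb) * (1 - k - pa + t)) =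
      (1 + t) * ((1 - pa - pb - k + 2 * t) * t - ((k - t) * (pa - t) + (k - t) * (pb - t) + (pa - t) * (pb - t))) -
        (k - t) * (pa - t) * (pb - t) := by ring
  have hAG : 0 ≤ (1 - pa - pb - k + 2 * t) * t - ((k - t) * (pa - t) + (k - t) * (pb - t) + (pa - t) * (pb - t)) := by
    by_contra hneg
    have : (1 + t) * ((1 - pa - pb - k + 2 * t) * t - ((k - t) * (pa - t) + (k - t) * (pb - t) + (pa - t) * (pb - t))) < 0 :=
      mul_neg_of_pos_of_neg (by linarith) (lt_of_not_ge hneg)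
    linarith
  have hL : 0 ≤ t * (1 - pa - pb - k + 2 * t) - (k - t) * (pa + pb - 2 * t) := by
    have e : t * (1 - pa - pb - k + 2 * t) - (k - t) * (pa + pb - 2 * t) =
        ((1 - pa - pb - k + 2 * t) * t - ((k - t) * (pa - t) + (k - t) * (pb - t) + (pa - t) * (pb - t))) + (pa - t) * (pb - t) := by ring
    rw [e]; exact add_nonneg hAG (mul_nonneg (sub_nonneg.2 hta) (sub_nonneg.2 htb))
  have hxt : 0 ≤ (1 - k) * t := mul_nonneg (sub_nonneg.2 hk1) ht0
  rcases le_total kc ky with hle | hle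
  · have key : 2 * ((1 - k) - (pa - t) * kc - (pb - t) * ky) + (1 - k) * (1 - pa * kc) * (1 - pb * ky) -
        ((1 - k) * (1 - pa * kc - pb * ky + t * kcy) + (1 - pa * kc) * ((1 - k) - (pb - t) * ky) +
          (1 - pb * ky) * ((1 - k) - (pa - t) * kc)) =
        (ky - kc) * (t - k * pb) + kc * ((1 - ky) * (t * (1 - pa - pb - k + 2 * t) - (k - t) * (pa + pb - 2 * t)) +
          ky * (2 * (1 - k - pa - pb + 2 * t) + (1 - k) * (1 - pa) * (1 - pb) -
            ((1 - k) * (1 - pa - pb + t) + (1 - pa) * (1 - k - pb + t) + (1 - pb) * (1 - k - pa + t)))) +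
          (kc - kcy) * ((1 - k) * t) := by ring
    rw [key]
    exact add_nonneg (add_nonneg (mul_nonneg (sub_nonneg.2 hle) (by linarith))
      (mul_nonneg hkc0 (add_nonneg (mul_nonneg (sub_nonneg.2 hky1) hL) (mul_nonneg hky0 h3)))) (mul_nonneg (sub_nonneg.2 hcyc) hxt)
  · have key : 2 * ((1 - k) - (pa - t) * kc - (pb - t) * ky) + (1 - k) * (1 - pa * kc) * (1 - pb * ky) -
        ((1 - k) * (1 - pa * kc - pb * ky + t * kcy) + (1 - pa * kc) * ((1 - k) - (pb - t) * ky) +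
          (1 - pb * ky) * ((1 - k) - (pa - t) * kc)) =
        (kc - ky) * (t - k * pa) + ky * ((1 - kc) * (t * (1 - pa - pb - k + 2 * t) - (k - t) * (pa + pb - 2 * t)) +
          kc * (2 * (1 - k - pa - pb + 2 * t) + (1 - k) * (1 - pa) * (1 - pb) -
            ((1 - k) * (1 - pa - pb + t) + (1 - pa) * (1 - k - pb + t) + (1 - pb) * (1 - k - pa + t)))) +
          (ky - kcy) * ((1 - k) * t) := by ring
    rw [key]
    exact add_nonneg (add_nonneg (mul_nonneg (sub_nonneg.2 hle) (by linarith))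
      (mul_nonneg hky0 (add_nonneg (mul_nonneg (sub_nonneg.2 hkc1) hL) (mul_nonneg hkc0 h3)))) (mul_nonneg (sub_nonneg.2 hcyy) hxt)

set_option maxHeartbeats 1600000 in
/-- **Row 36 across an `{a,b} | {c,y}` cut vertex** (the cut separates the middle edge `a–b` of the path `c–a–b–y` from both leaves).  If every
positive-weight edge avoiding `h` is monochromatic, `a, b` coloured `true` and `c, y` coloured `false`, then `0 ≤ E₃(D[a|b], D[a|c], D[b|y])` at
`(a,b,c,y)` — from Harris on the near side, the three-point lower bound `3PT-LB` at `(a,b,h)` and `P(h↔c ∧ h↔y) ≤ P(h↔c), P(h↔y)`. [this work] -/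
theorem sahiE3_row36_nonneg_of_cutVertexAB (w : Sym2 (Fin n) → unitInterval) (a b c y h : Fin n) (side : Fin n → Bool)
    (ha : side a = true) (hb : side b = true) (hc : side c = false) (hy : side y = false)
    (hw : ∀ u v : Fin n, u ≠ h → v ≠ h → side u ≠ side v → w s(u, v) = 0) :
    0 ≤ sahiE3 (prodBernoulli w) (connEvent (row 36 n (a, b, c, y)).1) (connEvent (row 36 n (a, b, c, y)).2.1)
      (connEvent (row 36 n (a, b, c, y)).2.2) := by
  classical
  have hrow : row 36 n (a, b, c, y) = (sep [a] [b], sep [a] [c], sep [b] [y]) := rfl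
  simp only [hrow, connEvent_sep]
  set μ := prodBernoulli w with hμ
  set X : Set (Set (Sym2 (Fin n))) := {ω | ∀ x ∈ [a], ∀ z ∈ [b], ω ∉ openConn x z} with hX
  set Y : Set (Set (Sym2 (Fin n))) := {ω | ∀ x ∈ [a], ∀ z ∈ [c], ω ∉ openConn x z} with hY
  set Z : Set (Set (Sym2 (Fin n))) := {ω | ∀ x ∈ [b], ∀ z ∈ [y], ω ∉ openConn x z} with hZ
  have hac : a ≠ c := fun e => by rw [e, hc] at ha; exact Bool.false_ne_true ha
  have hby : b ≠ y := fun e => by rw [e, hy] at hb; exact Bool.false_ne_true hb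
  have h3 := frontier_43_all w a b h c
  have hrow3 : row 43 n (a, b, h, c) = (sep [a] [b], sep [a] [h], sep [b] [h]) := rfl
  simp only [hrow3, connEvent_sep] at h3
  set F₁ : Finset (Sym2 (Fin n)) := Finset.univ.filter (fun e => ∀ u ∈ e, side u = true ∨ u = h) with hF₁
  set F₂ : Finset (Sym2 (Fin n)) :=
    Finset.univ.filter (fun e => (∀ u ∈ e, side u = false ∨ u = h) ∧ ¬ ∀ u ∈ e, u = h) with hF₂
  have mem₁ : ∀ e, e ∈ F₁ ↔ ∀ u ∈ e, side u = true ∨ u = h := fun e => by rw [hF₁, Finset.mem_filter]; simp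
  have mem₂ : ∀ e, e ∈ F₂ ↔ (∀ u ∈ e, side u = false ∨ u = h) ∧ ¬ ∀ u ∈ e, u = h := fun e => by
    rw [hF₂, Finset.mem_filter]; simp
  have hdisj : Disjoint F₁ F₂ := by
    rw [Finset.disjoint_left]
    intro e h1 h2
    rw [mem₁] at h1; rw [mem₂] at h2
    apply h2.2
    intro u hu
    rcases h1 u hu with h1 | h1
    · rcases h2.1 u hu with h2 | h2
      · rw [h1] at h2; exact absurd h2 (by decide)
      · exact h2
    · exact h1
  set D : Finset (Sym2 (Fin n)) := F₁ ∪ F₂ with hD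
  have hwD : ∀ e, e ∉ D → w e = 0 := by
    intro e he
    rw [hD, Finset.mem_union, not_or, mem₁, mem₂] at he
    obtain ⟨h1, h2⟩ := he
    induction e using Sym2.ind with
    | h u v =>
      have key : u ≠ h ∧ v ≠ h ∧ side u ≠ side v := by
        by_cases hu : u = h
        · subst hu
          exfalso
          by_cases hv : v = u
          · exact h1 fun x hx => Or.inr (by rcases Sym2.mem_iff.1 hx with e | e <;> [exact e; exact e.trans hv])
          · cases hsv : side v
            · exact h2 ⟨fun x hx => by rcases Sym2.mem_iff.1 hx with e | e <;> [exact Or.inr e; exact Or.inl (e ▸ hsv)],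
                fun hall => hv (hall v (Sym2.mem_iff.2 (Or.inr rfl)))⟩
            · exact h1 fun x hx => by rcases Sym2.mem_iff.1 hx with e | e <;> [exact Or.inr e; exact Or.inl (e ▸ hsv)]
        · by_cases hv : v = h
          · subst hv
            exfalso
            cases hsu : side u
            · exact h2 ⟨fun x hx => by rcases Sym2.mem_iff.1 hx with e | e <;> [exact Or.inl (e ▸ hsu); exact Or.inr e],
                fun hall => hu (hall u (Sym2.mem_iff.2 (Or.inl rfl)))⟩
            · exact h1 fun x hx => by rcases Sym2.mem_iff.1 hx with e | e <;> [exact Or.inl (e ▸ hsu); exact Or.inr e]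
          · refine ⟨hu, hv, fun hse => ?_⟩
            cases hsu : side u
            · exact h2 ⟨fun x hx => by
                  rcases Sym2.mem_iff.1 hx with e | e <;> [exact Or.inl (e ▸ hsu); exact Or.inl (e ▸ (hse ▸ hsu))],
                fun hall => hu (hall u (Sym2.mem_iff.2 (Or.inl rfl)))⟩
            · exact h1 fun x hx => by
                rcases Sym2.mem_iff.1 hx with e | e <;> [exact Or.inl (e ▸ hsu); exact Or.inl (e ▸ (hse ▸ hsu))]
      exact hw u v key.1 key.2.1 key.2.2
  have hT : ∀ ω : Set (Sym2 (Fin n)), ∀ v u u', (openGraph (ω ∩ ↑F₁)).Adj v u → (openGraph (ω ∩ ↑F₂)).Adj v u' → v = h := by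
    intro ω v u u' h1 h2
    rw [openGraph_adj] at h1 h2
    have e1 := (mem₁ _).1 (Finset.mem_coe.1 h1.1.2) v (Sym2.mem_iff.2 (Or.inl rfl))
    have e2 := ((mem₂ _).1 (Finset.mem_coe.1 h2.1.2)).1 v (Sym2.mem_iff.2 (Or.inl rfl))
    rcases e1 with e1 | e1
    · rcases e2 with e2 | e2
      · rw [e1] at e2; exact absurd e2 (by decide)
      · exact e2
    · exact e1
  have iso₂ : ∀ ω : Set (Sym2 (Fin n)), ∀ x, side x = true → x ≠ h → ∀ u, ¬ (openGraph (ω ∩ ↑F₂)).Adj x u := by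
    intro ω x hx hxh u hadj
    rw [openGraph_adj] at hadj
    rcases ((mem₂ _).1 (Finset.mem_coe.1 hadj.1.2)).1 x (Sym2.mem_iff.2 (Or.inl rfl)) with e | e
    · rw [hx] at e; exact Bool.noConfusion e
    · exact hxh e
  have iso₁ : ∀ ω : Set (Sym2 (Fin n)), ∀ x, side x = false → x ≠ h → ∀ u, ¬ (openGraph (ω ∩ ↑F₁)).Adj x u := by
    intro ω x hx hxh u hadj
    rw [openGraph_adj] at hadj
    rcases (mem₁ _).1 (Finset.mem_coe.1 hadj.1.2) x (Sym2.mem_iff.2 (Or.inl rfl)) with e | e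
    · rw [hx] at e; exact Bool.noConfusion e
    · exact hxh e
  have hsup : ∀ ω : Set (Sym2 (Fin n)), openGraph (ω ∩ ↑D) = openGraph (ω ∩ ↑F₁) ⊔ openGraph (ω ∩ ↑F₂) := by
    intro ω
    rw [hD, Finset.coe_union, Set.inter_union_distrib_left]
    exact SimpleGraph.fromEdgeSet_union _ _
  have pl : ∀ ω : Set (Sym2 (Fin n)),
      ((openGraph (ω ∩ ↑D)).Reachable a b ↔ (openGraph (ω ∩ ↑F₁)).Reachable a b) := by
    intro ω; rw [hsup ω]; exact reachable_sup_iff_left (hT ω) (iso₂ ω a ha) (iso₂ ω b hb)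
  have isoH : ∀ ω : Set (Sym2 (Fin n)), h ≠ h → ∀ u, ¬ (openGraph (ω ∩ ↑F₂)).Adj h u := fun ω hh => absurd rfl hh
  have plh : ∀ ω : Set (Sym2 (Fin n)), ∀ x, side x = true →
      ((openGraph (ω ∩ ↑D)).Reachable x h ↔ (openGraph (ω ∩ ↑F₁)).Reachable x h) := by
    intro ω x hx; rw [hsup ω]; exact reachable_sup_iff_left (hT ω) (iso₂ ω x hx) (isoH ω)
  have pc : ∀ ω : Set (Sym2 (Fin n)), ∀ x z, side x = true → side z = false → x ≠ z →
      ((openGraph (ω ∩ ↑D)).Reachable x z ↔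
        (openGraph (ω ∩ ↑F₁)).Reachable x h ∧ (openGraph (ω ∩ ↑F₂)).Reachable h z) := by
    intro ω x z hx hz hxz; rw [hsup ω]; exact reachable_sup_iff_cross (hT ω) (iso₂ ω x hx) (iso₁ ω z hz) hxz
  set EK : Set (Set (Sym2 (Fin n))) := {ω | ω ∩ ↑F₁ ∈ (openConn a b : Set (Set (Sym2 (Fin n))))} with hEK
  set EA : Set (Set (Sym2 (Fin n))) := {ω | ω ∩ ↑F₁ ∈ (openConn a h : Set (Set (Sym2 (Fin n))))} with hEA
  set EG : Set (Set (Sym2 (Fin n))) := {ω | ω ∩ ↑F₁ ∈ (openConn b h : Set (Set (Sym2 (Fin n))))} with hEG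
  set EC' : Set (Set (Sym2 (Fin n))) := {ω | ω ∩ ↑F₂ ∈ (openConn h c : Set (Set (Sym2 (Fin n))))} with hEC'
  set EY' : Set (Set (Sym2 (Fin n))) := {ω | ω ∩ ↑F₂ ∈ (openConn h y : Set (Set (Sym2 (Fin n))))} with hEY'
  set Sah : Set (Set (Sym2 (Fin n))) := {ω | ∀ x ∈ [a], ∀ z ∈ [h], ω ∉ openConn x z} with hSah
  set Sbh : Set (Set (Sym2 (Fin n))) := {ω | ∀ x ∈ [b], ∀ z ∈ [h], ω ∉ openConn x z} with hSbh
  have tX : {ω : Set (Sym2 (Fin n)) | ω ∩ ↑D ∈ X} = EKᶜ := by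
    ext ω
    simp only [hX, hEK, Set.mem_setOf_eq, List.mem_singleton, forall_eq, Set.mem_compl_iff, openConn]
    exact not_congr (pl ω)
  have tY : {ω : Set (Sym2 (Fin n)) | ω ∩ ↑D ∈ Y} = (EA ∩ EC')ᶜ := by
    ext ω
    simp only [hY, hEA, hEC', Set.mem_setOf_eq, List.mem_singleton, forall_eq, Set.mem_compl_iff, Set.mem_inter_iff, openConn]
    rw [pc ω a c ha hc hac]
  have tZ : {ω : Set (Sym2 (Fin n)) | ω ∩ ↑D ∈ Z} = (EG ∩ EY')ᶜ := by
    ext ω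
    simp only [hZ, hEG, hEY', Set.mem_setOf_eq, List.mem_singleton, forall_eq, Set.mem_compl_iff, Set.mem_inter_iff, openConn]
    rw [pc ω b y hb hy hby]
  have tSah : {ω : Set (Sym2 (Fin n)) | ω ∩ ↑D ∈ Sah} = EAᶜ := by
    ext ω
    simp only [hSah, hEA, Set.mem_setOf_eq, List.mem_singleton, forall_eq, Set.mem_compl_iff, openConn]
    rw [plh ω a ha]
  have tSbh : {ω : Set (Sym2 (Fin n)) | ω ∩ ↑D ∈ Sbh} = EGᶜ := by
    ext ω
    simp only [hSbh, hEG, Set.mem_setOf_eq, List.mem_singleton, forall_eq, Set.mem_compl_iff, openConn]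
    rw [plh ω b hb]
  have thin : ∀ X : Set (Set (Sym2 (Fin n))), μ.real X = μ.real {ω | ω ∩ ↑D ∈ X} :=
    fun X => real_eq_real_setOf_inter_mem w D hwD X
  have pre_inter : ∀ P Q : Set (Set (Sym2 (Fin n))),
      {ω : Set (Sym2 (Fin n)) | ω ∩ ↑D ∈ P ∩ Q} = {ω | ω ∩ ↑D ∈ P} ∩ {ω | ω ∩ ↑D ∈ Q} := fun P Q => rfl
  have ms : ∀ X : Set (Set (Sym2 (Fin n))), MeasurableSet X := fun X => (Set.toFinite _).measurableSet
  -- independence of the sides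
  have indep : ∀ P Q : Set (Set (Sym2 (Fin n))),
      μ.real ({ω | ω ∩ ↑F₁ ∈ P} ∩ {ω | ω ∩ ↑F₂ ∈ Q}) = μ.real {ω | ω ∩ ↑F₁ ∈ P} * μ.real {ω | ω ∩ ↑F₂ ∈ Q} := by
    intro P Q
    refine prodBernoulli_real_inter_of_determinedBy w F₁ ?_ ?_ (ms _) (ms _)
    · rw [determinedBy_iff]; intro ω ω' hω; simp only [Set.mem_setOf_eq, hω]
    · rw [determinedBy_iff]
      intro ω ω' hω
      have hsub : (↑F₂ : Set (Sym2 (Fin n))) ⊆ (↑F₁ : Set (Sym2 (Fin n)))ᶜ := fun e he he1 =>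
        Finset.disjoint_left.1 hdisj (Finset.mem_coe.1 he1) (Finset.mem_coe.1 he)
      have : ω ∩ ↑F₂ = ω' ∩ ↑F₂ := by
        rw [← Set.inter_eq_self_of_subset_right hsub, ← Set.inter_assoc, ← Set.inter_assoc, hω]
      simp only [Set.mem_setOf_eq, this]
  have cpl : ∀ S : Set (Set (Sym2 (Fin n))), μ.real Sᶜ = 1 - μ.real S := by
    intro S; rw [Set.compl_eq_univ_sdiff, measureReal_sdiff (Set.subset_univ _) (ms _)]; simp [hμ]
  have cc2 : ∀ P Q : Set (Set (Sym2 (Fin n))), μ.real (Pᶜ ∩ Qᶜ) = 1 - μ.real P - μ.real Q + μ.real (P ∩ Q) := by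
    intro P Q
    rw [← Set.compl_union, cpl]
    have h1 := measureReal_union_add_inter (μ := μ) (s := P) (ms Q)
    linarith
  have mC : ∀ S H : Set (Set (Sym2 (Fin n))), μ.real (S ∩ Hᶜ) = μ.real S - μ.real (S ∩ H) := by
    intro S H
    have e : S ∩ Hᶜ = S \ (S ∩ H) := by ext ω; simp only [Set.mem_inter_iff, Set.mem_compl_iff, Set.mem_sdiff]; tauto
    rw [e, measureReal_sdiff Set.inter_subset_left (ms _)]
  -- transitivity on the near side
  have eKA : EK ∩ EA = EA ∩ EG := by
    ext ω; simp only [hEK, hEA, hEG, Set.mem_inter_iff, Set.mem_setOf_eq, openConn]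
    exact ⟨fun hh => ⟨hh.2, hh.1.symm.trans hh.2⟩, fun hh => ⟨hh.1.trans hh.2.symm, hh.1⟩⟩
  have eKG : EK ∩ EG = EA ∩ EG := by
    ext ω; simp only [hEK, hEA, hEG, Set.mem_inter_iff, Set.mem_setOf_eq, openConn]
    exact ⟨fun hh => ⟨hh.1.trans hh.2, hh.2⟩, fun hh => ⟨hh.1.trans hh.2.symm, hh.2⟩⟩
  have eKAG : EK ∩ (EA ∪ EG) = EA ∩ EG := by
    rw [Set.inter_union_distrib_left, eKA, eKG, Set.union_self]
  have cc3 : μ.real (EKᶜ ∩ EAᶜ ∩ EGᶜ) = 1 - μ.real EK - μ.real EA - μ.real EG + 2 * μ.real (EA ∩ EG) := by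
    have e : EKᶜ ∩ EAᶜ ∩ EGᶜ = (EK ∪ (EA ∪ EG))ᶜ := by
      ext ω; simp only [Set.mem_inter_iff, Set.mem_compl_iff, Set.mem_union]; tauto
    rw [e, cpl]
    have h1 := measureReal_union_add_inter (μ := μ) (s := EK) (ms (EA ∪ EG))
    have h2 := measureReal_union_add_inter (μ := μ) (s := EA) (ms EG)
    rw [eKAG] at h1
    linarith
  -- independence instances
  have iAC : μ.real (EA ∩ EC') = μ.real EA * μ.real EC' := indep (openConn a h) (openConn h c)
  have iGY : μ.real (EG ∩ EY') = μ.real EG * μ.real EY' := indep (openConn b h) (openConn h y)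
  have iTT : μ.real ((EA ∩ EG) ∩ (EC' ∩ EY')) = μ.real (EA ∩ EG) * μ.real (EC' ∩ EY') :=
    indep (openConn a h ∩ openConn b h) (openConn h c ∩ openConn h y)
  have iAKC : μ.real ((EA ∩ EKᶜ) ∩ EC') = μ.real (EA ∩ EKᶜ) * μ.real EC' := indep (openConn a h ∩ (openConn a b)ᶜ) (openConn h c)
  have iGKY : μ.real ((EG ∩ EKᶜ) ∩ EY') = μ.real (EG ∩ EKᶜ) * μ.real EY' := indep (openConn b h ∩ (openConn a b)ᶜ) (openConn h y)
  have mAK : μ.real (EA ∩ EKᶜ) = μ.real EA - μ.real (EA ∩ EG) := by rw [mC, Set.inter_comm, eKA]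
  have mGK : μ.real (EG ∩ EKᶜ) = μ.real EG - μ.real (EA ∩ EG) := by rw [mC, Set.inter_comm, eKG]
  -- the seven probabilities of the glued row
  have eX : μ.real X = 1 - μ.real EK := by rw [thin, tX, cpl]
  have eY : μ.real Y = 1 - μ.real EA * μ.real EC' := by rw [thin, tY, cpl, iAC]
  have eZ : μ.real Z = 1 - μ.real EG * μ.real EY' := by rw [thin, tZ, cpl, iGY]
  have eYZ : μ.real (Y ∩ Z) = 1 - μ.real EA * μ.real EC' - μ.real EG * μ.real EY' + μ.real (EA ∩ EG) * μ.real (EC' ∩ EY') := by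
    rw [thin, pre_inter, tY, tZ, cc2, iAC, iGY]
    have e : (EA ∩ EC') ∩ (EG ∩ EY') = (EA ∩ EG) ∩ (EC' ∩ EY') := by
      ext ω; simp only [Set.mem_inter_iff]; tauto
    rw [e, iTT]
  have eXY : μ.real (X ∩ Y) = 1 - μ.real EK - (μ.real EA - μ.real (EA ∩ EG)) * μ.real EC' := by
    rw [thin, pre_inter, tX, tY]
    have e : EKᶜ ∩ (EA ∩ EC')ᶜ = EKᶜ \ ((EA ∩ EKᶜ) ∩ EC') := by
      ext ω; simp only [Set.mem_inter_iff, Set.mem_compl_iff, Set.mem_sdiff]; tauto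
    rw [e, measureReal_sdiff (fun ω hω => hω.1.2) (ms _), iAKC, mAK, cpl]
  have eXZ : μ.real (X ∩ Z) = 1 - μ.real EK - (μ.real EG - μ.real (EA ∩ EG)) * μ.real EY' := by
    rw [thin, pre_inter, tX, tZ]
    have e : EKᶜ ∩ (EG ∩ EY')ᶜ = EKᶜ \ ((EG ∩ EKᶜ) ∩ EY') := by
      ext ω; simp only [Set.mem_inter_iff, Set.mem_compl_iff, Set.mem_sdiff]; tauto
    rw [e, measureReal_sdiff (fun ω hω => hω.1.2) (ms _), iGKY, mGK, cpl]
  have eXYZ : μ.real (X ∩ Y ∩ Z) =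
      1 - μ.real EK - (μ.real EA - μ.real (EA ∩ EG)) * μ.real EC' - (μ.real EG - μ.real (EA ∩ EG)) * μ.real EY' := by
    rw [thin, pre_inter, pre_inter, tX, tY, tZ]
    have e : EKᶜ ∩ (EA ∩ EC')ᶜ ∩ (EG ∩ EY')ᶜ = EKᶜ \ (((EA ∩ EKᶜ) ∩ EC') ∪ ((EG ∩ EKᶜ) ∩ EY')) := by
      ext ω; simp only [Set.mem_inter_iff, Set.mem_compl_iff, Set.mem_sdiff, Set.mem_union]; tauto
    have hd : Disjoint ((EA ∩ EKᶜ) ∩ EC') ((EG ∩ EKᶜ) ∩ EY') := by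
      rw [Set.disjoint_left]
      intro ω h1 h2
      have hk : ω ∈ EK ∩ EA := by rw [eKA]; exact ⟨h1.1.1, h2.1.1⟩
      exact h1.1.2 hk.1
    rw [e, measureReal_sdiff (by
      intro ω hω
      rcases hω with h1 | h2
      · exact h1.1.2
      · exact h2.1.2) (ms _), measureReal_union hd (ms _), iAKC, iGKY, mAK, mGK, cpl]
    ring
  -- the three-point row on the near side, in the same variables
  rw [sahiE3_def] at h3
  have u1 : μ.real (X ∩ Sah ∩ Sbh) = 1 - μ.real EK - μ.real EA - μ.real EG + 2 * μ.real (EA ∩ EG) := by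
    rw [thin, pre_inter, pre_inter, tX, tSah, tSbh, cc3]
  have u2 : μ.real Sah = 1 - μ.real EA := by rw [thin, tSah, cpl]
  have u3 : μ.real Sbh = 1 - μ.real EG := by rw [thin, tSbh, cpl]
  have u4 : μ.real (Sah ∩ Sbh) = 1 - μ.real EA - μ.real EG + μ.real (EA ∩ EG) := by rw [thin, pre_inter, tSah, tSbh, cc2]
  have u5 : μ.real (X ∩ Sbh) = 1 - μ.real EK - μ.real EG + μ.real (EA ∩ EG) := by rw [thin, pre_inter, tX, tSbh, cc2, eKG]
  have u6 : μ.real (X ∩ Sah) = 1 - μ.real EK - μ.real EA + μ.real (EA ∩ EG) := by rw [thin, pre_inter, tX, tSah, cc2, eKA]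
  rw [u1, u4, u5, u6, u2, u3, eX] at h3
  -- cells and Harris on the near side, bounds on the far side
  have upPre₁ : ∀ u v : Fin n, IsUpperSet {ω : Set (Sym2 (Fin n)) | ω ∩ ↑F₁ ∈ (openConn u v : Set (Set (Sym2 (Fin n))))} :=
    fun u v ω ω' hle hω => isUpperSet_openConn u v (Set.inter_subset_inter_left _ hle) hω
  have trK : EA ∩ EG ⊆ EK := fun ω hω => by rw [← eKA] at hω; exact hω.1
  have trG : EA ∩ EK ⊆ EG := fun ω hω => by
    have : ω ∈ EK ∩ EA := ⟨hω.2, hω.1⟩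
    rw [eKA] at this; exact this.2
  have trA : EG ∩ EK ⊆ EA := fun ω hω => by
    have : ω ∈ EK ∩ EG := ⟨hω.2, hω.1⟩
    rw [eKG] at this; exact this.1
  obtain ⟨⟨c4, c1, c2, c3, -⟩, ⟨g1, g2, -⟩, -, -⟩ :=
    threePoint_side_facts w (upPre₁ a b) (upPre₁ a h) (upPre₁ b h) (ms _) (ms _) (ms _) trK trG trA
  have hk1 : μ.real EK ≤ 1 := (measureReal_mono (Set.subset_univ EK)).trans (le_of_eq (by simp [hμ]))
  have hkc1 : μ.real EC' ≤ 1 := (measureReal_mono (Set.subset_univ EC')).trans (le_of_eq (by simp [hμ]))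
  have hky1 : μ.real EY' ≤ 1 := (measureReal_mono (Set.subset_univ EY')).trans (le_of_eq (by simp [hμ]))
  have hcyc : μ.real (EC' ∩ EY') ≤ μ.real EC' := measureReal_mono Set.inter_subset_left
  have hcyy : μ.real (EC' ∩ EY') ≤ μ.real EY' := measureReal_mono Set.inter_subset_right
  rw [sahiE3_def, eXYZ, eXY, eXZ, eYZ, eX, eY, eZ]
  exact row36_cutVertexAB_ineq _ _ _ _ _ _ _ c4 c1 c2 c3 hk1 g1 g2 h3 measureReal_nonneg measureReal_nonneg hkc1 hky1 hcyc hcyy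

end Summit.CriticalPhenomena.PercolationContinuityZ3.Theorems.FrontierDecRows

end
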